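import Summits.CriticalPhenomena.PercolationContinuityZ3.Theorems.PercNearOneGluingNoHeavyLowerTailSurplusTransferPairTools
import HarnessLib

/-!
# Crux `NoHeavyLowerTail` (stmt-CriticalPhenomena-4575): the conditional covariance transfer COV-Π holds for the target `{v ∈ C(b)}`
# (the 4-terminal cubic "COV4") — first proved instance of COV-Π with a nonempty avoided vertex

Support file (`--supports stmt-CriticalPhenomena-4575`, prim-hp-4 gen 9).  No named facts, no sorries, no `Prop` definitions.

COV-Π (prim-gen-induct's V3_tPi; the one hypothesis left in `…NoHeavyLowerTailSurplusTransferPair.lean`) reads, for `ν = μ(· | a ↮ b)`,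
`D = {v ↮ a} ∩ {v ↮ b}` and an increasing `f` of `C(b)`:  `ν(D)·Cov_ν(f, 1{o ∈ C_b}) ≥ ν(o ↔ v, D)·Cov_ν(f, 1{v ∈ C_b})`.
Here it is PROVED for `f = 1{v ∈ C(b)}`, in the denominator-free form (`Q = {a ↮ b}`)

  `μ(D∩Q)·[μ(Q)·μ(o↔b, v↔b, Q) − μ(o↔b, Q)·μ(v↔b, Q)] ≥ μ(o↔v, D, Q)·μ(v↔b, Q)·μ(v↮b, Q)`      (`covTransfer_targetV`).

Proof (the "ν′-trick"): pass to `ν′ = μ(· | a ↮ {b, v})`.  On `{v ↔ b} ∩ Q` the separation `a ↮ v` is automatic; on `{v ↮ b} ∩ Q` the event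
`{o ↔ b}` is positively correlated with `{v ↮ a}` (both of type `(+)` for `(C_b, C_{{v,a}})`, BHK Thm 2.1 at `q = 1` with `S = {b}`, `T = {v,a}`);
and under `R = {a ↮ {b,v}}` every event in sight is monotone in `C_{{b,v}}`, so two more applications of the two-set exchange (`S = {a}`,
`T = {b, v}`: `{o ↔ {b,v}}`, `{v ↔ b}` of type `(−)`, `{v ↮ b}` of type `(+)`) finish.  With `a` absent the statement is Harris' inequality.
[cite: VandenbergHaggstromKahn2005, Thm. 2.1 (p. 9) at q = 1, Remark 1 (p. 5)]
-/

noncomputable section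

namespace Summit.CriticalPhenomena.PercolationContinuityZ3.Theorems.SurplusTransfer

open MeasureTheory Set
open Literature.Probability.LatticeModels (prodBernoulli)
open Literature.Probability.Percolation Literature.Probability.Percolation.KNPreFKG
open Literature.Probability.Percolation.TwoSetExchange

variable {V : Type*}

/-- The union of the events `{t ↔ x}` over a pair `{b, v}`. [folklore] -/
theorem biUnion_pair_openConn (b v x : V) :
    (⋃ t ∈ ({b, v} : Set V), (openConn t x : Set (BondConfig V))) = openConn b x ∪ openConn v x := by
  rw [biUnion_insert, biUnion_singleton]

section Measure

variable [Fintype V]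

/-- **COV-Π for the target `{v ∈ C(b)}` (COV4).**  With `Q = {a ↮ b}`, `D = {v ↮ a} ∩ {v ↮ b}`:
`μ(o↔v, D, Q)·μ(v↔b, Q)·μ(v↮b, Q) ≤ μ(D ∩ Q)·[μ(Q)·μ(o↔b, v↔b, Q) − μ(o↔b, Q)·μ(v↔b, Q)]`, i.e.
`ν(o∈C_b | v∈C_b) − ν(o∈C_b | v∉C_b) ≥ ν(o↔v | v↮a, v↮b)` under `ν = μ(·|a↮b)`.  Three applications of the two-set exchange inequality
(BHK Thm 2.1 at `q = 1`). [cite: VandenbergHaggstromKahn2005, Thm. 2.1 (p. 9) at q = 1, Remark 1 (p. 5)] -/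
theorem covTransfer_targetV (w : Sym2 V → unitInterval) (o v a b : V) :
    (prodBernoulli w).real (openConn o v ∩ ({ω : BondConfig V | ¬ (openGraph ω).Reachable v a} ∩ {ω | ¬ (openGraph ω).Reachable v b}) ∩
        (openConn a b)ᶜ) *
      (prodBernoulli w).real (openConn v b ∩ (openConn a b)ᶜ : Set (BondConfig V)) *
      (prodBernoulli w).real ((openConn v b)ᶜ ∩ (openConn a b)ᶜ : Set (BondConfig V)) ≤
    (prodBernoulli w).real (({ω : BondConfig V | ¬ (openGraph ω).Reachable v a} ∩ {ω | ¬ (openGraph ω).Reachable v b}) ∩ (openConn a b)ᶜ) *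
      ((prodBernoulli w).real ((openConn a b)ᶜ : Set (BondConfig V)) *
          (prodBernoulli w).real (openConn o b ∩ openConn v b ∩ (openConn a b)ᶜ : Set (BondConfig V)) -
        (prodBernoulli w).real (openConn o b ∩ (openConn a b)ᶜ : Set (BondConfig V)) *
          (prodBernoulli w).real (openConn v b ∩ (openConn a b)ᶜ : Set (BondConfig V))) := by
  classical
  set μ := prodBernoulli w with hμ
  have hmeas : ∀ T : Set (BondConfig V), MeasurableSet T := fun _ => MeasurableSet.of_discrete
  have hn := fun (S : Set (BondConfig V)) => (measureReal_nonneg : 0 ≤ μ.real S)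
  -- names
  set Q : Set (BondConfig V) := (openConn a b)ᶜ with hQ
  set R : Set (BondConfig V) := {ω | ¬ (openGraph ω).Reachable a b} ∩ {ω | ¬ (openGraph ω).Reachable a v} with hR
  set Nv : Set (BondConfig V) := (openConn v b)ᶜ with hNv      -- `v ∉ C_b`
  set Na : Set (BondConfig V) := (openConn v a)ᶜ with hNa      -- `v ↮ a`
  set Ob : Set (BondConfig V) := openConn o b with hOb
  set Vb : Set (BondConfig V) := openConn v b with hVb
  set Ov : Set (BondConfig V) := openConn o v with hOv
  set U : Set (BondConfig V) := openConn b o ∪ openConn v o with hU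
  -- (F2) world `S = {b}`, `T = {v, a}`: `{b ↔ o}` and `{v ↮ a}` positively correlated
  have hF2 := setTwoClusterExchange w ({b} : Set V) ({v, a} : Set V)
    (A₁ := openConn b o) (B₁ := univ) (A₂ := (openConn v a : Set (BondConfig V))ᶜ) (B₂ := univ)
    (typePlus_openConn_of_mem {b} {v, a} (by simp) o)
    (typePlus_not_openConn_of_mem_mem {b} {v, a} (by simp))
    (fun _ _ _ _ _ => mem_univ _) (fun _ _ _ _ _ => mem_univ _)
  -- (1′), (2′) world `S = {a}`, `T = {b, v}`
  have h1 := setTwoClusterExchange w ({a} : Set V) ({b, v} : Set V)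
    (A₁ := univ) (B₁ := ⋃ t ∈ ({b, v} : Set V), (openConn t o : Set (BondConfig V))) (A₂ := univ) (B₂ := openConn b v)
    (fun _ _ _ _ _ => mem_univ _) (fun _ _ _ _ _ => mem_univ _)
    (typeMinus_biUnion_openConn {a} {b, v} o) (typeMinus_openConn_of_mem {a} {b, v} (by simp) v)
  have h2 := setTwoClusterExchange w ({a} : Set V) ({b, v} : Set V)
    (A₁ := (openConn b v : Set (BondConfig V))ᶜ) (B₁ := ⋃ t ∈ ({b, v} : Set V), (openConn t o : Set (BondConfig V)))
    (A₂ := univ) (B₂ := univ)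
    (typePlus_not_openConn_of_mem {a} {b, v} (by simp) v) (fun _ _ _ _ _ => mem_univ _)
    (typeMinus_biUnion_openConn {a} {b, v} o) (fun _ _ _ _ _ => mem_univ _)
  simp only [sep_singleton_pair, inter_univ, univ_inter, biUnion_pair_openConn] at hF2 h1 h2
  -- rename the events to `Ob, Vb, Nv, Na, U, R`
  rw [openConn_symm b o] at hF2
  rw [openConn_symm b v] at h1 h2
  have hDb : {ω : BondConfig V | ¬ (openGraph ω).Reachable b v} ∩ {ω | ¬ (openGraph ω).Reachable b a} = Nv ∩ Q := by
    ext ω; simp only [mem_inter_iff, mem_setOf_eq, mem_compl_iff, openConn, hNv, hQ]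
    exact ⟨fun ⟨h1, h2⟩ => ⟨fun h => h1 h.symm, fun h => h2 h.symm⟩, fun ⟨h1, h2⟩ => ⟨fun h => h1 h.symm, fun h => h2 h.symm⟩⟩
  rw [hDb] at hF2
  change μ.real (Nv ∩ Q ∩ Ob) * μ.real (Nv ∩ Q ∩ Na) ≤ μ.real (Nv ∩ Q ∩ (Ob ∩ Na)) * μ.real (Nv ∩ Q) at hF2
  change μ.real (R ∩ U) * μ.real (R ∩ Vb) ≤ μ.real R * μ.real (R ∩ (U ∩ Vb)) at h1
  change μ.real (R ∩ (Vbᶜ ∩ U)) * μ.real R ≤ μ.real (R ∩ Vbᶜ) * μ.real (R ∩ U) at h2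
  -- set identities
  have hRdef : ∀ ω : BondConfig V, ω ∈ R ↔ ¬ (openGraph ω).Reachable a b ∧ ¬ (openGraph ω).Reachable a v := fun ω => Iff.rfl
  have eVb : (Vb ∩ Q : Set (BondConfig V)) = R ∩ Vb := by
    ext ω; simp only [mem_inter_iff, mem_compl_iff, openConn, mem_setOf_eq, hVb, hQ, hRdef]
    constructor
    · rintro ⟨hvb, hab⟩; exact ⟨⟨hab, fun hav => hab (hav.trans hvb)⟩, hvb⟩
    · rintro ⟨⟨hab, _⟩, hvb⟩; exact ⟨hvb, hab⟩
  have eOVb : (Ob ∩ Vb ∩ Q : Set (BondConfig V)) = R ∩ (U ∩ Vb) := by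
    ext ω; simp only [mem_inter_iff, mem_compl_iff, mem_union, openConn, mem_setOf_eq, hVb, hQ, hOb, hU, hRdef]
    constructor
    · rintro ⟨⟨hob, hvb⟩, hab⟩; exact ⟨⟨hab, fun hav => hab (hav.trans hvb)⟩, Or.inl hob.symm, hvb⟩
    · rintro ⟨⟨hab, _⟩, h | h, hvb⟩
      · exact ⟨⟨h.symm, hvb⟩, hab⟩
      · exact ⟨⟨h.symm.trans hvb, hvb⟩, hab⟩
  have eDQ : ({ω : BondConfig V | ¬ (openGraph ω).Reachable v a} ∩ {ω | ¬ (openGraph ω).Reachable v b}) ∩ Q = Nv ∩ Q ∩ Na := by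
    ext ω; simp only [mem_inter_iff, mem_compl_iff, openConn, mem_setOf_eq, hNv, hQ, hNa]; tauto
  have eDQ' : Nv ∩ Q ∩ Na = R ∩ Vbᶜ := by
    ext ω; simp only [mem_inter_iff, mem_compl_iff, openConn, mem_setOf_eq, hNv, hQ, hNa, hVb, hRdef]
    constructor
    · rintro ⟨⟨hvb, hab⟩, hva⟩; exact ⟨⟨hab, fun h => hva h.symm⟩, hvb⟩
    · rintro ⟨⟨hab, hav⟩, hvb⟩; exact ⟨⟨hvb, hab⟩, fun h => hav h.symm⟩
  have eOvDQ : Ov ∩ ({ω : BondConfig V | ¬ (openGraph ω).Reachable v a} ∩ {ω | ¬ (openGraph ω).Reachable v b}) ∩ Q =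
      (R ∩ (Vbᶜ ∩ U)) \ (Nv ∩ Q ∩ (Ob ∩ Na)) := by
    ext ω
    simp only [mem_inter_iff, mem_compl_iff, mem_sdiff, mem_union, openConn, mem_setOf_eq, hNv, hQ, hNa, hVb, hOv, hOb, hU, hRdef]
    constructor
    · rintro ⟨⟨hov, hva, hvb⟩, hab⟩
      refine ⟨⟨⟨hab, fun hav => hva hav.symm⟩, hvb, Or.inr hov.symm⟩, ?_⟩
      rintro ⟨⟨_, _⟩, hob, _⟩
      exact hvb (hov.symm.trans hob)
    · rintro ⟨⟨⟨hab, hav⟩, hvb, hU'⟩, hnot⟩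
      rcases hU' with hob | hvo
      · exact absurd ⟨⟨hvb, hab⟩, hob.symm, fun h => hav h.symm⟩ hnot
      · exact ⟨⟨hvo.symm, fun h => hav h.symm, hvb⟩, hab⟩
  have hsubU : Nv ∩ Q ∩ (Ob ∩ Na) ⊆ R ∩ (Vbᶜ ∩ U) := by
    intro ω hω
    simp only [mem_inter_iff, mem_compl_iff, mem_union, openConn, mem_setOf_eq, hNv, hQ, hNa, hVb, hOb, hU, hRdef] at hω ⊢
    obtain ⟨⟨hvb, hab⟩, hob, hva⟩ := hω
    exact ⟨⟨hab, fun h => hva h.symm⟩, hvb, Or.inl hob.symm⟩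
  have eOvR : μ.real (Ov ∩ ({ω : BondConfig V | ¬ (openGraph ω).Reachable v a} ∩ {ω | ¬ (openGraph ω).Reachable v b}) ∩ Q) =
      μ.real (R ∩ (Vbᶜ ∩ U)) - μ.real (Nv ∩ Q ∩ (Ob ∩ Na)) := by
    rw [eOvDQ, measureReal_sdiff hsubU (hmeas _)]
  -- `μ(Ob ∩ Q) = μ(Ob ∩ Vb ∩ Q) + μ(Nv ∩ Q ∩ Ob)` and `μ(Q) = μ(Vb ∩ Q) + μ(Nv ∩ Q)`
  have eObQ : μ.real (Ob ∩ Q : Set (BondConfig V)) = μ.real (Ob ∩ Vb ∩ Q : Set (BondConfig V)) + μ.real (Nv ∩ Q ∩ Ob) := by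
    rw [← measureReal_inter_add_sdiff (s := (Ob ∩ Q : Set (BondConfig V))) (h := measure_ne_top _ _) (hmeas Vb)]
    congr 1
    · congr 1; ext ω; simp only [mem_inter_iff]; tauto
    · congr 1; ext ω; simp only [mem_inter_iff, mem_sdiff, hNv, mem_compl_iff]; tauto
  have eQ : μ.real Q = μ.real (Vb ∩ Q : Set (BondConfig V)) + μ.real (Nv ∩ Q) := by
    rw [← measureReal_inter_add_sdiff (s := Q) (h := measure_ne_top _ _) (hmeas Vb)]
    congr 1
    · rw [inter_comm]
    · congr 1; ext ω; simp only [mem_inter_iff, mem_sdiff, hNv, mem_compl_iff]; tauto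
  -- real arithmetic
  rw [eOvR, eObQ, eQ, eDQ, eOVb, eVb]
  rw [eDQ'] at hF2 ⊢
  set r := μ.real R
  set dR := μ.real (R ∩ Vbᶜ)
  set dQ := μ.real (Nv ∩ Q)
  set oLvQ := μ.real (Nv ∩ Q ∩ Ob)
  set oLvR := μ.real (Nv ∩ Q ∩ (Ob ∩ Na))
  set vLR := μ.real (R ∩ Vb)
  set UvL := μ.real (R ∩ (U ∩ Vb))
  set UR := μ.real (R ∩ U)
  set UnR := μ.real (R ∩ (Vbᶜ ∩ U))
  -- hF2 : oLvQ * dR ≤ oLvR * dQ ; h1 : UR * vLR ≤ r * UvL ; h2 : UnR * r ≤ dR * UR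
  have hstep : r * (dR * UvL) ≥ r * (vLR * UnR) :=
    calc r * (dR * UvL) = dR * (r * UvL) := by ring
      _ ≥ dR * (UR * vLR) := mul_le_mul_of_nonneg_left h1 (hn _)
      _ = vLR * (dR * UR) := by ring
      _ ≥ vLR * (UnR * r) := mul_le_mul_of_nonneg_left h2 (hn _)
      _ = r * (vLR * UnR) := by ring
  have hkey : vLR * UnR ≤ dR * UvL := by
    by_cases hr0 : r = 0
    · have h0 : dR = 0 := le_antisymm (hr0 ▸ measureReal_mono inter_subset_left (measure_ne_top _ _)) (hn _)
      have h0' : vLR = 0 := le_antisymm (hr0 ▸ measureReal_mono inter_subset_left (measure_ne_top _ _)) (hn _)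
      rw [h0, h0']; simp
    · exact le_of_mul_le_mul_left hstep (lt_of_le_of_ne (hn _) (Ne.symm hr0))
  -- goal: (UnR - oLvR) * vLR * dQ ≤ dR * ((vLR + dQ) * UvL - (UvL + oLvQ) * vLR)
  have e1 : dR * ((vLR + dQ) * UvL - (UvL + oLvQ) * vLR) = dQ * (dR * UvL) - vLR * (oLvQ * dR) := by ring
  rw [e1]
  nlinarith [hF2, hkey, hn (Nv ∩ Q), hn (R ∩ Vb), mul_le_mul_of_nonneg_left hF2 (hn (R ∩ Vb)),
    mul_le_mul_of_nonneg_left hkey (hn (Nv ∩ Q))]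

end Measure

end Summit.CriticalPhenomena.PercolationContinuityZ3.Theorems.SurplusTransfer

end
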